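import Summits.Schanuel.Schanuel.Theorems.RootDecomp1HSubst

/-!
# RootDecomp1HSubstTwist — part 2/2 of the port of lens-5 gen 14 «TWIST» kernel `Subst.lean` (fb1d4a48…): §5 the WORKED INSTANCE = PORT TEMPLATE
for TWIST31 (`TwistB0`: one twisted type-B system with a unimodular pivot — `twL` / `twG` / `twCoef`, `hid`, `cell_clean`).
Split off only for the 400-line lint; namespace and texts verbatim. `--supports stmt-Schanuel-27287` (FinCS; serves FinCSSigma 26888 equally).
Sorry-free; standard axioms. Nothing here proves Schanuel; rung 0.
-/

set_option linter.dupNamespace false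

noncomputable section

namespace Summit.Schanuel.Schanuel.Theorems.RootDecomp1HSubst

open Complex Set
open Literature.NumberTheory.Transcendental (SchanuelRank)
open Summit.Schanuel.Schanuel.Theses.RootDecomp1H (ProductSchanuel RelTowerSchanuel BridgeTransverse FinCS)
open Summit.Schanuel.Schanuel.Theorems.RootDecomp1HClearance (LowerRanks CounterEx InTowerHull
  towerTuple_of_counterEx_rank_le_two)
open Summit.Schanuel.Schanuel.Theorems.RootDecomp1HHull (not_lt_of_inTowerHull)
open Summit.Schanuel.Schanuel.Theorems.RootDecomp1HGauge

variable {n : ℕ}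


/-! ## §5 Worked instance = the PORT TEMPLATE for TWIST31 (one twisted type-B system, unimodular pivot)

The swap-symmetric system `{y₃ − e^{y₁} − e^{y₂} + 1, y₁ − y₂ − e^{y₁} + e^{y₂}, y₁ + y₂ + y₃ + e^{y₁} + e^{y₂} + e^{y₃} + 1}`
(pilot candidate at `y = (w, w̄, x)`, `w ≈ 0.583946 + 1.760822 i`, `x ≈ −1.677377`).  Pivot columns `(X₁, X₃, Y₃)`
have a UNIMODULAR minor, so the substitution is integral: `X₁ ↦ X₂ + Y₁ − Y₂`, `X₃ ↦ Y₁ + Y₂ − 1`,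
`Y₃ ↦ −2X₂ − 3Y₁ − Y₂`, free coordinates `(y₂, e^{y₁}, e^{y₂})`; the three ideal identities are checked by `ring`.
The census then owes exactly ONE numerical fact per point, `SubstExcl (aeval twG) y 4` (no integer polynomial of degree
`≤ 4`, height `≤ H₀ ≤ 4·210·6⁴` in the free coordinates vanishes), and `cell_clean` closes the FinCS and FinCSΣ cell
instances with every binder discarded. -/
namespace TwistB0

open MvPolynomial (X C aeval) in
/-- The three forms, as `ℚ`-polynomials in `X (inl j) = y_j`, `X (inr j) = e^{y_j}`. -/
noncomputable def twL : Fin 3 → QPoly 3 :=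
  ![X (Sum.inl 2) - X (Sum.inr 0) - X (Sum.inr 1) + 1,
    X (Sum.inl 0) - X (Sum.inl 1) - X (Sum.inr 0) + X (Sum.inr 1),
    X (Sum.inl 0) + X (Sum.inl 1) + X (Sum.inl 2) + X (Sum.inr 0) + X (Sum.inr 1) + X (Sum.inr 2) + 1]

open MvPolynomial (X C aeval) in
/-- The pivot substitution (pivots `X₁, X₃, Y₃`; free `X₂, Y₁, Y₂`). -/
noncomputable def twG : Fin 3 ⊕ Fin 3 → QPoly 3 :=
  Sum.elim ![X (Sum.inl 1) + X (Sum.inr 0) - X (Sum.inr 1), X (Sum.inl 1), X (Sum.inr 0) + X (Sum.inr 1) - 1]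
    ![X (Sum.inr 0), X (Sum.inr 1), -2 * X (Sum.inl 1) - 3 * X (Sum.inr 0) - X (Sum.inr 1)]

/-- The (constant, integral) ideal coefficients: `X₁ − twG X₁ = L₂`, `X₃ − twG X₃ = L₁`, `Y₃ − twG Y₃ = −L₁ − L₂ + L₃`. -/
noncomputable def twCoef : Fin 3 ⊕ Fin 3 → Fin 3 → QPoly 3 :=
  Sum.elim ![![0, 1, 0], ![0, 0, 0], ![1, 0, 0]] ![![0, 0, 0], ![0, 0, 0], ![-1, -1, 1]]

/-- `∀ s, MvPolynomial.X s - twG s = ∑ k, twCoef s k * twL k`. -/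
theorem hid : ∀ s, MvPolynomial.X s - twG s = ∑ k, twCoef s k * twL k := by
  rintro (i | i) <;> fin_cases i <;> simp [twG, twCoef, twL, Fin.sum_univ_three] <;> ring

/-- `AlongForms` for this system at any of its zeros. -/
theorem alongForms {y : Fin 3 → ℂ} (hy : ∀ k, MvPolynomial.aeval (pt y) (twL k) = 0) :
    AlongForms twL (MvPolynomial.aeval twG) y :=
  alongForms_of_coeffs twL twG twCoef hid hy

/-- The zero condition in analytic form. -/
theorem zeros_of_eqs {y : Fin 3 → ℂ} (h₁ : y 2 - cexp (y 0) - cexp (y 1) + 1 = 0)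
    (h₂ : y 0 - y 1 - cexp (y 0) + cexp (y 1) = 0)
    (h₃ : y 0 + y 1 + y 2 + cexp (y 0) + cexp (y 1) + cexp (y 2) + 1 = 0) :
    ∀ k, MvPolynomial.aeval (pt y) (twL k) = 0 := by
  intro k
  fin_cases k <;> simpa [twL, pt] using by assumption

/-- THE CELL INSTANCE of this system at a zero `y`, from the census fact `SubstExcl (aeval g) y N`, under ANY binders. -/
theorem cell_clean {y : Fin 3 → ℂ} (h₁ : y 2 - cexp (y 0) - cexp (y 1) + 1 = 0)
    (h₂ : y 0 - y 1 - cexp (y 0) + cexp (y 1) = 0)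
    (h₃ : y 0 + y 1 + y 2 + cexp (y 0) + cexp (y 1) + cexp (y 2) + 1 = 0) {N : ℕ}
    (hex : SubstExcl (MvPolynomial.aeval twG) y N) (H₁ H₂ H₃ : Prop) :
    H₁ → H₂ → H₃ →
      (¬ LinearIndependent ℚ y ∨
        ¬ ∃ P : Fin (3 + 1) → MvPolynomial (Fin 3 ⊕ Fin 3) ℤ, (∀ i, psize (P i) ≤ N) ∧ IsCertificate 3 y P) :=
  cell_clean_of_substExcl (alongForms (zeros_of_eqs h₁ h₂ h₃)) hex H₁ H₂ H₃

end TwistB0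

end Summit.Schanuel.Schanuel.Theorems.RootDecomp1HSubst
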